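import Literature.AnabelianGeometry.EtaleTheta.SettingModelTateZNStandardSplitting
import Literature.AnabelianGeometry.EtaleTheta.SettingModelChiZNAllSplittings
import Literature.AnabelianGeometry.EtaleTheta.SettingModelTateOrigin
import HarnessLib

/-!
# The STAGE-2 model: the origin clause `GtpZNFromSplitting` for ALL lifted splittings
# (stage-2 twin of `SettingModelChiZNAllSplittings`; proof-only)

Mochizuki, *The étale theta function and its Frobenioid-theoretic manifestations*, Publ. RIMS **45** (2009) [EtTh],
§1 p. 14 («`J_N := K_N(a^{1/N})_{a ∈ K_N}` … Since any two splittings … differ by a cohomology class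
∈ `H¹(G_{K_N}, ℤ/Nℤ(1))`, it follows [by the definition of `J_N`] that all splittings … determine the same splitting
over `G_{J_N}` … `Π^tp_{Z_N}`») [cite: MochizukiEtTh2009, §1 p.14].

abc-iut cell, layer L2, seat abc-iut-L2-t1 (§1 ROOT owner, gen 7; K3 row (ii) of the gen-6 census addendum v3,
abc-iut-L2-lead R552/R556/R578 — row CLAIMED first by abc-iut-w5-d062 g5, who designed the χ-model argument ported
here and yielded the filing to the holder of the farm-clean draft; the Summits-side unconditional twin is theirs).
PROOF-ONLY stage-2 twin, at abc-iut-L2-t5's `ThetaSetting.modelχq p i j hj`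
(`Π^tp_X = Γ ⋊_{actχq} G_{ℚ_p}`, `K := ℚ_p`, `q_X := p²`), of abc-iut-w5-d062's `SettingModelChiZNAllSplittings`
(p458978, the χ-model), over abc-iut-L2-d1's `SettingModelTateZNStandardSplitting` (`N·(Δ^tp_Y)^Θ` in level
coordinates and the clause for the STANDARD splitting `σ ↦ θ(inr σ)` at stage 2). The Tate shear of `actχq` is
invisible on degree `0` for `σ ∈ G_{K_N}` (`(tateTwistData₀).hlev₀` + `χ_N(σ) = 1`), so w5-d062's three-step argument
ports verbatim:
1. the LEVEL CHARACTER `σ ↦ ĥ_N(γ_σ).z` of a lifted splitting (lifts `g_σ = (γ_σ, σ) ∈ Π^tp_{Y_N}`) is a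
   homomorphism `G_{K_N} → ℤ/N` (`levelHom_left_z_mul_of_splitting_χq`);
2. + 3. it kills `G_{J_N}` — strong completeness of `G_{ℚ_p}` (hypothesis `hsc`, verbatim the Summits-side theorem
   `Summit.ABC.IUTFork.stronglyComplete_GQp`, p461655) and Kummer containment, packaged once and for all in
   w5-d062's `apply_eq_one_of_mem_GJN_of_stronglyComplete` (consumed BY NAME);
hence every lifted splitting agrees with the standard one on `G_{J_N}` modulo `N·(Δ^tp_Y)^Θ`, and L2-d1's clause
for the standard splitting transfers:
* **`gtpZNFromSplitting_modelχq_of_stronglyComplete (hsc) : (modelχq p i j hj).GtpZNFromSplitting N`** (all `i`,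
  even `j`, all `N`);
* **`exists_isEtThOrigin_isTateOrigin_gtpZNFromSplitting (hsc)`** — NV in the census shape: SOME theta setting
  is SIMULTANEOUSLY of [EtTh] origin, a Tate origin (`IsTateOrigin`, abc-iut-L2-t6/w5-d051's print-faithful
  Tate-module clause at every level; `modelχq_isTateOrigin` at `j = 2`) AND satisfies `GtpZNFromSplitting` at
  every level — a joint witness of two of the covering inputs of this seat's K3 end-knit v5
  `Thm16Sub.thm16iii_of_origins` (p462527), modulo `hsc` (unconditional once composed Summits-side).
SEMI-SYNTHETIC MODEL, consistency evidence only; nothing of [EtTh] asserted; no side taken on [IUTchIII] Cor. 3.12;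
typed ≠ proved.
-/

noncomputable section

namespace Literature.AnabelianGeometry.EtaleTheta.SettingModel

open Literature.AnabelianGeometry.SemiGraphs _root_.Function

variable (p : ℕ) [Fact p.Prime] (i j : ℤ) (hj : Even j) (N : ℕ+)

/-! ### Bookkeeping in `Γ ⋊_{actχq} G_{ℚ_p}` -/

/-- In `Γ ⋊_{actχq} G`: two elements with the same `G`-component differ by `inl` of the quotient of their
`Γ`-components. [cite: MochizukiEtTh2009, §1 p.12] -/
theorem mul_inv_eq_inl_of_right_eq_χq {g h : PiTpχq p i j} (hr : g.right = h.right) :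
    g * h⁻¹ = SemidirectProduct.inl (g.left * h.left⁻¹) := by
  refine SemidirectProduct.ext ?_ ?_
  · rw [SemidirectProduct.mul_left, SemidirectProduct.inv_left, SemidirectProduct.left_inl, ← MulAut.mul_apply,
      ← map_mul, hr, mul_inv_cancel, map_one, MulAut.one_apply]
  · rw [SemidirectProduct.mul_right, SemidirectProduct.inv_right, SemidirectProduct.right_inl, hr, mul_inv_cancel]

/-- An element of `Π^tp_{Y_N}` (stage 2) has `Γ`-component in `Δ^tp_{Y_N} ⊆ Ker pr₂` and `G`-component in `G_{K_N}`.
[cite: MochizukiEtTh2009, §1 p.13] -/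
theorem left_mem_dY_of_mem_YNχq {g : PiTpχq p i j} (hg : g ∈ YNχq p i j N) :
    g.left ∈ dY N ∧ g.left ∈ gfpSnd.ker ∧ g.right ∈ (fieldKN ⊥ (qModel p) N).fixingSubgroup := by
  obtain ⟨hl, hr⟩ := (GfpTwistData₀.mem_YN (tateTwistData₀ p i j)).mp hg
  exact ⟨hl, dY_le N hl, hr⟩

/-- **The Tate shear is invisible on degree `0` over `G_{K_N}`**: for `σ ∈ G_{K_N}` (so `χ_N(σ) = 1`) and `γ ∈ Ker pr₂`,
`ĥ_N(σ·γ) = ĥ_N(γ)` (`(tateTwistData₀).hlev₀`: on degree `0` the level shadow of `actχq σ` is the diagonal twist by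
`χ_N(σ)`). [cite: MochizukiEtTh2009, §1 p.13] -/
theorem levelHom_actχq_of_mem_GKN_of_mem_ker {σ : GQp p} (hσ : σ ∈ (fieldKN ⊥ (qModel p) N).fixingSubgroup)
    {γ : Gfp} (hγ : γ ∈ gfpSnd.ker) : levelHom N (actχq p i j σ γ) = levelHom N γ := by
  have h := (tateTwistData₀ p i j).hlev₀ N σ γ (MonoidHom.mem_ker.mp hγ)
  rw [h]
  change Heis.diagTwist (ZHatLevel.levelChar N (chi p σ)) (levelHom N γ) = levelHom N γ
  rw [levelChar_chi_eq_one_of_mem_fixingSubgroup p hσ]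
  ext <;> simp

/-! ### (1) The level character of a lifted splitting (stage 2) -/

section Splitting

variable {p i j N}
variable {g : ↥((ThetaSetting.modelχq p i j hj).GKN N) → PiTpχq p i j}

/-- **The level character is multiplicative (stage 2).**  If `g_σ ∈ Π^tp_{Y_N}` lies over `σ` and the images `θ(g_σ)`
form a splitting modulo `N·(Δ^tp_Y)^Θ`, then `ĥ_N(γ_{στ}) = ĥ_N(γ_σ)·ĥ_N(γ_τ)` for the `Γ`-components `γ_σ = g_σ.left`.
[cite: MochizukiEtTh2009, §1 p.14] -/
theorem levelHom_left_mul_of_splitting_χq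
    (hgY : ∀ σ, g σ ∈ YNχq p i j N) (hgr : ∀ σ, (g σ).right = (σ : GQp p))
    (hmul : ∀ σ τ, CurveTheta.toTheta (curveχq p i j) (g (σ * τ)) *
      (CurveTheta.toTheta (curveχq p i j) (g σ) * CurveTheta.toTheta (curveχq p i j) (g τ))⁻¹ ∈
        (ThetaSetting.modelχq p i j hj).thetaPowersY N)
    (σ τ : ↥((ThetaSetting.modelχq p i j hj).GKN N)) :
    levelHom N (g (σ * τ)).left = levelHom N (g σ).left * levelHom N (g τ).left := by
  have h := hmul σ τ
  rw [← map_mul, ← map_inv, ← map_mul] at h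
  have hright : (g (σ * τ)).right = (g σ * g τ).right := by
    rw [SemidirectProduct.mul_right, hgr, hgr, hgr, Subgroup.coe_mul]
  rw [mul_inv_eq_inl_of_right_eq_χq p i j hright] at h
  have hker₁ : (g (σ * τ)).left ∈ gfpSnd.ker := (left_mem_dY_of_mem_YNχq p i j N (hgY _)).2.1
  have hkerσ : (g σ).left ∈ gfpSnd.ker := (left_mem_dY_of_mem_YNχq p i j N (hgY _)).2.1
  have hkerτ : (g τ).left ∈ gfpSnd.ker := (left_mem_dY_of_mem_YNχq p i j N (hgY _)).2.1
  have hker₂ : (g σ * g τ).left ∈ gfpSnd.ker := by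
    rw [SemidirectProduct.mul_left]
    refine mul_mem hkerσ ?_
    rw [MonoidHom.mem_ker, (tateTwistData₀ p i j).hdeg]
    exact hkerτ
  have hmem : (g (σ * τ)).left * (g σ * g τ).left⁻¹ ∈ gfpSnd.ker := mul_mem hker₁ (inv_mem hker₂)
  rw [toThetaq_inl_mem_thetaPowersY_iff p i j hj N hmem, map_mul, map_inv, mul_inv_eq_one] at h
  rw [h, SemidirectProduct.mul_left, map_mul, hgr, levelHom_actχq_of_mem_GKN_of_mem_ker p i j N σ.2 hkerτ]

/-- The `z`-coordinates of the level shadows ADD (stage 2): `σ ↦ ĥ_N(γ_σ).z` is a homomorphism `G_{K_N} → ℤ/N`.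
[cite: MochizukiEtTh2009, §1 p.14] -/
theorem levelHom_left_z_mul_of_splitting_χq
    (hgY : ∀ σ, g σ ∈ YNχq p i j N) (hgr : ∀ σ, (g σ).right = (σ : GQp p))
    (hmul : ∀ σ τ, CurveTheta.toTheta (curveχq p i j) (g (σ * τ)) *
      (CurveTheta.toTheta (curveχq p i j) (g σ) * CurveTheta.toTheta (curveχq p i j) (g τ))⁻¹ ∈
        (ThetaSetting.modelχq p i j hj).thetaPowersY N)
    (σ τ : ↥((ThetaSetting.modelχq p i j hj).GKN N)) :
    (levelHom N (g (σ * τ)).left).z = (levelHom N (g σ).left).z + (levelHom N (g τ).left).z := by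
  rw [levelHom_left_mul_of_splitting_χq hj hgY hgr hmul σ τ, Heis.mul_z,
    (levelHom_mem_zAxis_of_mem_dY N (left_mem_dY_of_mem_YNχq p i j N (hgY σ)).1).1, zero_mul, add_zero]

end Splitting

/-! ### The origin clause for `Z_N` at the stage-2 model, for ALL splittings -/

/-- **`GtpZNFromSplitting (modelχq p i j hj) N` for EVERY lifted splitting, granted strong completeness of `G_{ℚ_p}`**
(stage-2 twin of w5-d062's `gtpZNFromSplitting_modelχ_of_stronglyComplete`): the level character of a lifted splitting
kills `G_{J_N}` (`apply_eq_one_of_mem_GJN_of_stronglyComplete`), so the splitting agrees with `θ ∘ inr` on `G_{J_N}`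
modulo `N·(Δ^tp_Y)^Θ`, and L2-d1's level-coordinate description of `N·(Δ^tp_Y)^Θ`
(`toThetaq_inl_mem_thetaPowersY_iff`) gives the clause. [cite: MochizukiEtTh2009, §1 p.14] -/
theorem gtpZNFromSplitting_modelχq_of_stronglyComplete
    (hsc : ∀ U : Subgroup (GQp p), U.FiniteIndex → IsOpen (U : Set (GQp p))) :
    (ThetaSetting.modelχq p i j hj).GtpZNFromSplitting N := by
  intro s hs g
  -- lifts of the splitting
  choose lift hliftY hliftaug hliftθ using hs.exists_lift
  have hliftr : ∀ σ, (lift σ).right = (σ : GQp p) := fun σ => hliftaug σ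
  have hmul : ∀ σ τ, CurveTheta.toTheta (curveχq p i j) (lift (σ * τ)) *
      (CurveTheta.toTheta (curveχq p i j) (lift σ) * CurveTheta.toTheta (curveχq p i j) (lift τ))⁻¹ ∈
        (ThetaSetting.modelχq p i j hj).thetaPowersY N := by
    intro σ τ
    have h := hs.map_mul_mem σ τ
    rw [← hliftθ, ← hliftθ, ← hliftθ] at h
    exact h
  -- the level character `f : G_{K_N} → ℤ/N`
  let f : ↥((fieldKN ⊥ (qModel p) N).fixingSubgroup) →* Multiplicative (ZMod N) :=
    MonoidHom.mk' (fun σ => Multiplicative.ofAdd (levelHom N (lift σ).left).z) fun σ τ => by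
      rw [← ofAdd_add]
      exact congrArg Multiplicative.ofAdd (levelHom_left_z_mul_of_splitting_χq hj hliftY hliftr hmul σ τ)
  -- it kills `G_{J_N}`
  have hJ : ∀ (σ : GQp p) (hσ : σ ∈ (fieldJN ⊥ (qModel p) N).fixingSubgroup),
      levelHom N (lift ⟨σ, (ThetaSetting.modelχq p i j hj).GJN_le_GKN N hσ⟩).left = 1 := by
    intro σ hσ
    obtain ⟨h, h1⟩ := apply_eq_one_of_mem_GJN_of_stronglyComplete p N hsc f hσ
    have hz : (levelHom N (lift ⟨σ, (ThetaSetting.modelχq p i j hj).GJN_le_GKN N hσ⟩).left).z = 0 :=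
      ofAdd_eq_one.mp h1
    exact (levelHom_eq_one_iff_z_eq_zero (left_mem_dY_of_mem_YNχq p i j N (hliftY _)).1).mpr hz
  -- the clause, as in the standard case, with `inl(γ_σ)·inr σ` for `inr σ`
  constructor
  · intro hZ
    obtain ⟨hl, hr⟩ := (GfpTwistData₀.mem_ZN (tateTwistData₀ p i j)).mp hZ
    have hY : g ∈ (ThetaSetting.modelχq p i j hj).GtpYN N :=
      (GfpTwistData₀.mem_YN (tateTwistData₀ p i j)).mpr
        ⟨dZ_le_dY N hl, (ThetaSetting.modelχq p i j hj).GJN_le_GKN N hr⟩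
    refine ⟨hY, hr, ?_⟩
    set σ' : ↥((ThetaSetting.modelχq p i j hj).GKN N) :=
      ⟨(ThetaSetting.modelχq p i j hj).aug g, (ThetaSetting.modelχq p i j hj).GJN_le_GKN N hr⟩
    rw [← hliftθ σ']
    change CurveTheta.toTheta (curveχq p i j) g * (CurveTheta.toTheta (curveχq p i j) (lift σ'))⁻¹ ∈ _
    have hright : g.right = (lift σ').right := by rw [hliftr]; rfl
    have hJ' : levelHom N (lift σ').left = 1 := hJ _ hr
    rw [← map_inv, ← map_mul, mul_inv_eq_inl_of_right_eq_χq p i j hright,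
      toThetaq_inl_mem_thetaPowersY_iff p i j hj N
        (mul_mem (Subgroup.mem_inf.mp hl).1 (inv_mem (left_mem_dY_of_mem_YNχq p i j N (hliftY σ')).2.1)),
      map_mul, map_inv, hJ', inv_one, mul_one]
    exact (Subgroup.mem_inf.mp hl).2
  · rintro ⟨hY, hr, hmem⟩
    obtain ⟨hl, -⟩ := (GfpTwistData₀.mem_YN (tateTwistData₀ p i j)).mp hY
    have hs' : g.left ∈ gfpSnd.ker := (Subgroup.mem_inf.mp hl).1
    set σ' : ↥((ThetaSetting.modelχq p i j hj).GKN N) :=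
      ⟨(ThetaSetting.modelχq p i j hj).aug g, (ThetaSetting.modelχq p i j hj).GJN_le_GKN N hr⟩
    rw [← hliftθ σ'] at hmem
    change CurveTheta.toTheta (curveχq p i j) g * (CurveTheta.toTheta (curveχq p i j) (lift σ'))⁻¹ ∈ _ at hmem
    have hright : g.right = (lift σ').right := by rw [hliftr]; rfl
    have hJ' : levelHom N (lift σ').left = 1 := hJ _ hr
    rw [← map_inv, ← map_mul, mul_inv_eq_inl_of_right_eq_χq p i j hright,
      toThetaq_inl_mem_thetaPowersY_iff p i j hj N
        (mul_mem hs' (inv_mem (left_mem_dY_of_mem_YNχq p i j N (hliftY σ')).2.1)),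
      map_mul, map_inv, hJ', inv_one, mul_one] at hmem
    exact (GfpTwistData₀.mem_ZN (tateTwistData₀ p i j)).mpr ⟨Subgroup.mem_inf.mpr ⟨hs', hmem⟩, hr⟩

/-- **`GtpZNFromSplitting` at the stage-2 model for ALL splittings and all levels, granted topological finite
generation of `G_{ℚ_p}`** (w5-d062's `stronglyComplete_GQp_of_tfg`). [cite: MochizukiEtTh2009, §1 p.14]
[cite: NikolovSegal2003, Thm 1.1] -/
theorem gtpZNFromSplitting_modelχq
    (hG : AbsoluteAnabelian.IsTopologicallyFinitelyGenerated (Field.absoluteGaloisGroup ℚ_[p])) (N : ℕ+) :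
    (ThetaSetting.modelχq p i j hj).GtpZNFromSplitting N :=
  gtpZNFromSplitting_modelχq_of_stronglyComplete p i j hj N (stronglyComplete_GQp_of_tfg p hG)

/-! ### NV in the census shape: a joint witness of `IsTateOrigin` and `GtpZNFromSplitting` -/

/-- **Joint NV of two covering inputs of the K3 end-knit v5** (`Thm16Sub.thm16iii_of_origins`, p462527): granted strong
completeness of `G_{ℚ_p}`, SOME theta setting is of [EtTh] origin, is a Tate origin (the print-faithful Tate-module
clause at EVERY level) AND satisfies the origin clause `GtpZNFromSplitting` at every level — the stage-2 model
`modelχq p 0 2` (`modelχq_isEtThOrigin`, `modelχq_isTateOrigin`, and the theorem above; every `i` works).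
[cite: MochizukiEtTh2009, §1 p.14] -/
theorem exists_isEtThOrigin_isTateOrigin_gtpZNFromSplitting
    (hsc : ∀ U : Subgroup (GQp p), U.FiniteIndex → IsOpen (U : Set (GQp p))) :
    ∃ D : ThetaSetting p, D.IsEtThOrigin ∧ D.IsTateOrigin ∧ ∀ N, D.GtpZNFromSplitting N :=
  ⟨ThetaSetting.modelχq p 0 2 even_two, ThetaSetting.modelχq_isEtThOrigin p 0 2 even_two,
    modelχq_isTateOrigin p 0, fun N => gtpZNFromSplitting_modelχq_of_stronglyComplete p 0 2 even_two N hsc⟩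

end Literature.AnabelianGeometry.EtaleTheta.SettingModel

end
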